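import Summits.ResolutionOfSingularities.ResolutionOfSingularities.Theorems.MaxContactCutWallCutCells
import Summits.ResolutionOfSingularities.ResolutionOfSingularities.Theorems.SurfacePortCells
import HarnessLib

/-!
# MaxContactCutSurfacePort — decomp-res node «SurfacePort» (lens-4 g31, critic row 182 CLEARED DECIDED-MOD-PORT(M+)
+1 · MAP 0 now), tree file 3/3 of the node

Content VERBATIM from the decomp-res lens-4 g31 node `HOME/decomp-res-lens-4/g31/SurfacePort.lean` (pin b367c4d1;
imports the landed tree only; the carried
§86 block is the landed `WallCutCells`, dropped); HOME = run/shared/lean/pub/decomp-res; critic row 182 CLEARED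
DECIDED-MOD-PORT(M+) +1 · MAP 0 now; landing orders INBOX :896/:909 —
provenance, critic text and the lens header in full in the first file of the node, `SurfacePort`.  Namespace
`…Theorems.HugValuationCut`; `--supports
stmt-ResolutionOfSingularities-28338`.

## This file

THE §91 COROLLARIES GIVEN 31571 `MaxContactCut.NoContactHuggingTowers` BY NAME (in the Theses cone):
`noWildKangarooOffDoublePointTowers_iff_g31 (h71) (h640)` · `noWildKangarooOffLocusTowers_iff_g31` ·
`noWildPPowerOffLocusTowers_iff_g31` · `noWildContactFreeOffLocusTowers_iff_g31` (+ any §91 link that cites the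
g28–g30 h71 families) — TREE ASIDE 28338 / the g25–g30 residuals ⟺ the g31 located residual MODULO the port
`SurfaceChainPort`, through `MaxContactCutWallCutCells`'s `…_iff_g30 (h71)` family and
`noWildWallFreeFreshJumpShallowCompanionKangarooTowers_iff_g31 (h640)`.  Imports `MaxContactCutWallCutCells` +
`SurfacePortCells`; 0 sorry.

[WRITER NOTE (decomp-res writer g11): file split only (tree files ≤ 400 lines); namespace, sections, section
variables and every declaration exactly as in the
lens (the node's global dupNamespace-linter line is dropped — the library sets it; the `open …Theses` line lives
only in the Theses-cone file; the imports
`HistoryCutCells` / `MaxContactCutSatelliteCut` of the lens are replaced by `WallCutCells` (⊇ both ring-level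
chains, cone-free) resp. moved to the cone file).]

(Sources: CossartJannsenSaito2020 Thm. 6.40, Def. 6.38–6.39 pp. 103–104, Thm. 6.35 / Cor. 6.37; Hauser2010Kangaroo;
HauserPerlega2019 §2; Hironaka1964 Ch. III (τ, directrix); Giraud1975; CossartPiltant2008 §2; Matsumura1987;
StacksProject 0804 / 0BIQ.)
-/

noncomputable section

open CategoryTheory AlgebraicGeometry IsLocalRing TopologicalSpace
open Literature.AlgebraicGeometry.Resolution
open Summit.ResolutionOfSingularities.ResolutionOfSingularities.Theses
open Summit.ResolutionOfSingularities.ResolutionOfSingularities.Theorems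
open WeakOrderReduction ForcedTowerClasses DivergentTowerClasses MonomialTowerClasses
open HugDimensionClasses HugDimensionKernels SurfaceShadowClasses SurfaceShadowKernels
open NearPointCut (SingularClass)
open Scheme.IdealSheafData (vanishingIdeal)
open scoped BigOperators

namespace Summit.ResolutionOfSingularities.ResolutionOfSingularities.Theorems.HugValuationCut

section SurfaceCells

/-- **GIVEN 31571 AND THE PORT: the g25 residual ⟺ the non-surface residual.** [folklore] -/
theorem noWildKangarooOffDoublePointTowers_iff_g31 (h71 : MaxContactCut.NoContactHuggingTowers) (h640 : SurfaceChainPort) :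
    NoWildKangarooOffDoublePointTowers ↔ NoWildNonSurfaceWallFreeFreshJumpShallowCompanionKangarooTowers :=
  (noWildKangarooOffDoublePointTowers_iff_g30 h71).trans (noWildWallFreeFreshJumpShallowCompanionKangarooTowers_iff_g31 h640)

/-- **GIVEN 31571 AND THE PORT: g24's kangaroo residual ⟺ the non-surface residual.** [folklore] -/
theorem noWildKangarooOffLocusTowers_iff_g31 (h71 : MaxContactCut.NoContactHuggingTowers) (h640 : SurfaceChainPort) :
    NoWildKangarooOffLocusTowers ↔ NoWildNonSurfaceWallFreeFreshJumpShallowCompanionKangarooTowers :=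
  (noWildKangarooOffLocusTowers_iff_g30 h71).trans (noWildWallFreeFreshJumpShallowCompanionKangarooTowers_iff_g31 h640)

/-- **GIVEN 31571 AND THE PORT: g23's `p`-power residual ⟺ the non-surface residual.** [folklore] -/
theorem noWildPPowerOffLocusTowers_iff_g31 (h71 : MaxContactCut.NoContactHuggingTowers) (h640 : SurfaceChainPort) :
    NoWildPPowerOffLocusTowers ↔ NoWildNonSurfaceWallFreeFreshJumpShallowCompanionKangarooTowers :=
  (noWildPPowerOffLocusTowers_iff_g30 h71).trans (noWildWallFreeFreshJumpShallowCompanionKangarooTowers_iff_g31 h640)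

/-- **GIVEN 31571 AND THE PORT, THE TREE ASIDE 28338 ⟺ THE g31 RESIDUAL** — `NoWildContactFreeOffLocusTowers` ⟺ the non-surface
wall-free fresh-jump shallow companion-recurrent residual. [folklore] -/
theorem noWildContactFreeOffLocusTowers_iff_g31 (h71 : MaxContactCut.NoContactHuggingTowers) (h640 : SurfaceChainPort) :
    NoWildContactFreeOffLocusTowers ↔ NoWildNonSurfaceWallFreeFreshJumpShallowCompanionKangarooTowers :=
  (noWildContactFreeOffLocusTowers_iff_g30 h71).trans (noWildWallFreeFreshJumpShallowCompanionKangarooTowers_iff_g31 h640)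

end SurfaceCells

end Summit.ResolutionOfSingularities.ResolutionOfSingularities.Theorems.HugValuationCut
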